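import Literature.Computability.Cryptography.RegevBDDToLWESamples
import Literature.Computability.Cryptography.RegevNoiseGrid
import HarnessLib

/-!
# Regev 2009, Lemma 3.11 with INTEGER noise: the manufactured `LWE` sample is an exact function of a lattice sample and the integer `⌊L·e⌋`

Topic `Computability/Cryptography` (family `pqc`), grouping namespace `Regev2009`; sequel of
`RegevBDDToLWESamples.lean` (the sample map `bddLWESampleOf b p D x α₀`: `v ← D`, `e ∼ N(0, α₀²/(2π))`,
output `(L⁻¹v mod p, ⌊p(⟨x,v⟩/p + e)⌉ mod p)`) and of `RegevNoiseGrid.lean` (rounding through a finer even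
grid). Everything here is PROVED; one definition with body (`floorGaussian`); no named fact.

The idealised experiments of Regev's classical reduction (`bddLWESampleOf`, and everything built on it up to
`Regev2009.regevBDD`) draw a CONTINUOUS Gaussian `e`; a machine draws an integer. This file removes the
real number from the experiment without changing its law: with `L = p·N`, `N` even, and `L·c ∈ ℤ` for the
grid point `c = ⟨x, v⟩/p` (true when `N` is a multiple of the denominators of `⟨x, v⟩`, e.g. of `det B` for
`x ∈ ℤⁿ`, `v ∈ L(B)*`),

* `floorGaussian L α₀ : PMF ℤ` — the law of `⌊L·e⌋`, `e ∼ N(0, α₀²/(2π))` (what the machine must sample);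
* `noiseZMod_eq_map_floorGaussian` — **`⌊p(c + e)⌉ mod p = ((L·c + ⌊L·e⌋ + N/2) div N) mod p` in law**:
  `noiseZMod p α₀ c = (floorGaussian (p·N) α₀).map (j ↦ ((k + j + N/2)/N : ℤ) mod p)` for `L·c = k ∈ ℤ`
  (pointwise identity `discretize_eq_of_floor` + `floor_mul_add_of_mem_grid`, pushed through `Measure.map`);
* `bddLWESampleOf_eq_bind_floorGaussian` — hence the manufactured sample is the image of the pair
  `(v, ⌊L·e⌋)` under an explicit integer-arithmetic map, for every source `D` of lattice vectors whose
  samples have `N·⟨x, v⟩ ∈ ℤ`: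
  `bddLWESampleOf b p D x α₀ = D.bind (v ↦ (floorGaussian (pN) α₀).map (j ↦ (L⁻¹v mod p, ((N⟨x,v⟩ + j + N/2) div N) mod p)))`.

So a machine holding `v` (exact rational coordinates) and an integer sample `j` with law `floorGaussian`
reproduces the idealised sample EXACTLY; only the statistical distance of its integer sampler from
`floorGaussian` enters the final bound. (The fine samples at modulus `pK` are the case `p ↦ pK`.)

## References

* O. Regev, *On lattices, learning with errors, random linear codes, and cryptography*, J. ACM 56
  (2009), art. 34, Lemma 3.11 (proof, Eq. (10)) and §2 (`Ψ̄ = ⌊p·⌉ mod p`) [RegevLWE2009].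
* C. Peikert, *Public-key cryptosystems from the worst-case shortest vector problem*, STOC 2009, full
  version p. 7 ("a suitable amount of precision") [Peikert2009].
-/

noncomputable section

open MeasureTheory ProbabilityTheory
open scoped Real ENNReal InnerProductSpace NNReal

namespace Literature.Computability.Cryptography

namespace Regev2009

/-! ### The integer Gaussian sample `⌊L·e⌋` -/

/-- Measurability of `e ↦ ⌊L·e⌋`. [folklore] -/
theorem measurable_floor_mul (L : ℝ) : Measurable fun e : ℝ => ⌊L * e⌋ :=
  Int.measurable_floor.comp (measurable_const_mul L)

/-- LOCAL GLUE. **The integer noise sample**: the law of `⌊L·e⌋` for `e ∼ N(0, α₀²/(2π))` (a floor-rounded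
Gaussian of standard deviation `Lα₀/√(2π)` on `ℤ`) — the object a machine samples in place of the real `e`.
[cite: RegevLWE2009, Lemma 3.11 (proof: "`e` … a normal variable with standard deviation `α/(2√π)`")] -/
def floorGaussian (L : ℕ) (α₀ : ℝ) : PMF ℤ :=
  haveI : IsProbabilityMeasure ((gaussianReal 0 (Real.toNNReal (α₀ ^ 2 / (2 * π)))).map fun e : ℝ => ⌊(L : ℝ) * e⌋) :=
    Measure.isProbabilityMeasure_map (measurable_floor_mul (L : ℝ)).aemeasurable
  ((gaussianReal 0 (Real.toNNReal (α₀ ^ 2 / (2 * π)))).map fun e : ℝ => ⌊(L : ℝ) * e⌋).toPMF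

/-- Pushing a probability measure through a composite equals mapping its `PMF` image (countable targets).
[folklore] -/
theorem toPMF_map_comp {Ω A B : Type*} [MeasurableSpace Ω] [MeasurableSpace A] [MeasurableSingletonClass A]
    [Countable A] [MeasurableSpace B] [MeasurableSingletonClass B] [Countable B] (μ : Measure Ω)
    [IsProbabilityMeasure μ] {F : Ω → A} (hF : Measurable F) {G : A → B} (hG : Measurable G) :
    haveI : IsProbabilityMeasure (μ.map (G ∘ F)) := Measure.isProbabilityMeasure_map (hG.comp hF).aemeasurable
    haveI : IsProbabilityMeasure (μ.map F) := Measure.isProbabilityMeasure_map hF.aemeasurable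
    (μ.map (G ∘ F)).toPMF = (μ.map F).toPMF.map G := by
  haveI : IsProbabilityMeasure (μ.map (G ∘ F)) := Measure.isProbabilityMeasure_map (hG.comp hF).aemeasurable
  haveI : IsProbabilityMeasure (μ.map F) := Measure.isProbabilityMeasure_map hF.aemeasurable
  apply PMF.toMeasure_injective
  rw [Measure.toPMF_toMeasure, ← PMF.toMeasure_map G _ hG, Measure.toPMF_toMeasure, Measure.map_map hG hF]

/-! ### `⌊p(c + e)⌉ mod p` as an integer function of `⌊L·e⌋` -/

/-- **The discretised noise is an exact integer function of `⌊L·e⌋`** (`L = p·N`, `N` even, `L·c ∈ ℤ`):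
`noiseZMod p α₀ c` — the law of `⌊p(c + e)⌉ mod p` — is the image of `floorGaussian (p·N) α₀` under
`j ↦ ((L·c + j + N/2) div N) mod p`. [cite: RegevLWE2009, §2 (`Ψ̄_α = ⌊p·⌉ mod p`) with Lemma 3.11 (proof)] -/
theorem noiseZMod_eq_map_floorGaussian (p : ℕ) [NeZero p] {N : ℕ} (hN : 2 ∣ N) (hN0 : 0 < N) (α₀ c : ℝ)
    (k : ℤ) (hk : ((p * N : ℕ) : ℝ) * c = k) :
    noiseZMod p α₀ c = (floorGaussian (p * N) α₀).map
      fun j : ℤ => (((k + j + (N / 2 : ℕ)) / (N : ℤ) : ℤ) : ZMod p) := by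
  have hpN : 0 < p * N := Nat.mul_pos (Nat.pos_of_ne_zero (NeZero.ne p)) hN0
  -- the pointwise identity
  have hfun : (fun e : ℝ => LWE.discretize p (c + e)) =
      (fun j : ℤ => (((k + j + (N / 2 : ℕ)) / (N : ℤ) : ℤ) : ZMod p)) ∘ fun e : ℝ => ⌊((p * N : ℕ) : ℝ) * e⌋ := by
    funext e
    simp only [Function.comp_apply]
    rw [discretize_eq_of_floor p hN hN0 (c + e), floor_mul_add_of_mem_grid k hk]
  unfold noiseZMod floorGaussian
  have hG : Measurable fun j : ℤ => (((k + j + (N / 2 : ℕ)) / (N : ℤ) : ℤ) : ZMod p) := measurable_of_countable _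
  simp only [hfun]
  exact toPMF_map_comp _ (measurable_floor_mul _) hG

/-! ### The manufactured sample from `(v, ⌊L·e⌋)` -/

section Sample

variable {E : Type*} [NormedAddCommGroup E] [InnerProductSpace ℝ E]
variable {L : Submodule ℤ E}
variable {ι : Type} (b : Module.Basis ι ℤ L) (p : ℕ) [NeZero p]

/-- **Regev's sample map with integer noise** (Lemma 3.11, Eq. (10), made exact in integer arithmetic): if
`N` is even and `N·⟨x, v⟩ ∈ ℤ` for every lattice vector `v` the source `D` can produce (any `N` divisible by
the denominators of `⟨x, ·⟩` on the sampled lattice), then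
`bddLWESampleOf b p D x α₀ = D.bind (v ↦ (floorGaussian (pN) α₀).map (j ↦ (L⁻¹v mod p, ((N⟨x,v⟩ + j + N/2) div N) mod p)))`.
[cite: RegevLWE2009, Lemma 3.11 (proof, Eq. (10))] -/
theorem bddLWESampleOf_eq_bind_floorGaussian (D : PMF L) (x : E) (α₀ : ℝ) {N : ℕ} (hN : 2 ∣ N) (hN0 : 0 < N)
    (num : L → ℤ) (hnum : ∀ v : L, (N : ℝ) * ⟪x, (v : E)⟫_ℝ = num v) :
    bddLWESampleOf b p D x α₀ = D.bind fun v =>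
      (floorGaussian (p * N) α₀).map fun j : ℤ =>
        (coeffMod b p v, (((num v + j + (N / 2 : ℕ)) / (N : ℤ) : ℤ) : ZMod p)) := by
  unfold bddLWESampleOf
  refine congrArg _ (funext fun v => ?_)
  have hk : ((p * N : ℕ) : ℝ) * (⟪x, (v : E)⟫_ℝ / p) = num v := by
    have hp : (p : ℝ) ≠ 0 := NeZero.ne (p : ℝ)
    rw [← hnum v]; push_cast; field_simp
  rw [noiseZMod_eq_map_floorGaussian p hN hN0 α₀ _ (num v) hk, PMF.map_comp]
  rfl

end Sample

end Regev2009

end Literature.Computability.Cryptography
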